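import Literature.MathematicalPhysics.QuantumFieldTheory.Balaban1983to89.B12LaurentSplit522
import Literature.MathematicalPhysics.QuantumFieldTheory.Balaban1983to89.B12LaurentSplitting522Proof

/-!
# `Balaban1983to89.B12LaurentSplit522Bridge` — [Balaban1987RG1] §5 p. 294 «It is unique up to an additive constant»
# applied ACROSS the two formalizations of the one-variable Laurent splitting `f(z) = g⁺(z) + g⁻(z⁻¹)`: the explicit
# Cauchy-integral pair OF RECORD (`B12LaurentSplit522.gPlus`/`gMinus`, unit r09) versus the existence-and-uniqueness
# theorems of the TWIN (`B12LaurentSplitting522Proof`, unit p10)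

statement-level skeleton of published theorems with citation tags; proofs where landed; nothing here is a claim
about the Yang–Mills mass gap

Mega-formalization `lit-balaban` (HOME `run/shared/lean/pub/lit-balaban/`), unit `lit-balaban-r20` gen 18 (B12 fold
owner and DEFINITIONS steward; «register pair → theorem» lane).  THEOREMS ONLY — no new object, no `Prop` fact,
nothing withdrawn or re-typed.  SKELETON row served: B12.Eq5.22-5.26 (display owner r09) — SUPPORT cell only, no head
change (the row is `proved` on r09's/p10's files).

THE PRINTED SENTENCE ([I] p. 294 = PDF 46): *«a given function f(z) analytic on the ring {e^{−δ₁} < |z| < e^{δ₁}} can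
be represented as f(z) = g⁺(z) + g⁻(z⁻¹), where g⁺(z), g⁻(z) are analytic on the disc {|z| < e^{δ₁}}. This
representation is obtained by taking regular and singular parts of the Laurent expansion. It is unique up to an
additive constant.»*  The cell holds it twice (ref-5 gen-3 TWIN notice; steward's ruling in `lit-balaban-r20/ROWS-B12.md`
v1.12: decl OF RECORD = r09's explicit pair, p10's file kept as an independent proof, no merge filing):

* r09 `B12LaurentSplit522` (p242586): the EXPLICIT pair `gPlus f r₂ w = (2πi)⁻¹∮_{|z|=r₂} f(z)(z − w)⁻¹dz`,
  `gMinus f r₁ u = u·(2πi)⁻¹∮_{|ζ|=r₁⁻¹} ζ⁻¹f(ζ⁻¹)(ζ − u)⁻¹dζ` (normalised by `gMinus f r₁ 0 = 0`) at auxiliary radii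
  `R⁻¹ < r₁ < |w| < r₂ < R` strictly inside the ring, holomorphic on `|w| < r₂` resp. `|u| < r₁⁻¹`
  (`laurent_split`, `differentiableOn_gPlus/gMinus`), with uniqueness lemmas under the printed normalisations; its
  transcript note (T1) records that the PATCHING of these radius-dependent objects to the full printed disc
  `|z| < R = e^{δ₁}` «is not typed here».
* p10 `B12LaurentSplitting522Proof` (p243202): `laurent_splitting` — EXISTENCE of a splitting `(g⁺, g⁻)` holomorphic
  on the FULL disc `|z| < R`; `laurent_splitting_unique` — any two such splittings differ by `(c, −c)`.

THIS FILE (the bridge; every statement for `1 < R`, `f` holomorphic on `R⁻¹ < |z| < R`, radii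
`R⁻¹ < r₁ < 1 < r₂ < R`, common disc `D = {|z| < R′}`, `R′ = min(r₂, r₁⁻¹) > 1`):
* §1 `gPlus_gMinus_eq_of_splitting` — for EVERY splitting `(g⁺, g⁻)` holomorphic on `|z| < R` with
  `f = g⁺ + g⁻(1/·)` on the ring:  `gPlus f r₂ = g⁺ + g⁻(0)` and `gMinus f r₁ = g⁻ − g⁻(0)` on `D` — print's «unique up
  to an additive constant» ACROSS the pair, the constant being PINNED by r09's normalisation `g⁻(0) = 0`;
  `gPlus_gMinus_eq_of_splitting_of_norm` — if moreover `g⁻(0) = 0` the splitting IS r09's pair on `D`.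
* §2 `exists_extension_gPlus_gMinus` — r09's (T1) patching, typed: there are `G⁺, G⁻` holomorphic on the FULL disc
  `|z| < R`, `G⁻(0) = 0`, splitting `f` on the whole ring, which AGREE with `gPlus f r₂`, `gMinus f r₁` on `D`
  (p10's existence + §1); hence r09's explicit objects are independent of the auxiliary radii:
  `gPlus f r₂ = gPlus f r₂′` on `|z| < min(r₂, r₂′)` and `gMinus f r₁ = gMinus f r₁′` on `|z| < min(r₁⁻¹, r₁′⁻¹)`
  (`gPlus_eq_gPlus_of_radii`, `gMinus_eq_gMinus_of_radii`).

HONEST SCOPE.  (i) Elementary consequences of the two landed files (Liouville-type uniqueness is p10's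
`laurent_splitting_unique`; existence on the full disc is p10's `laurent_splitting`; the explicit pair and its
splitting identity are r09's); no new analysis.  (ii) `R′ = min(r₂, r₁⁻¹)` is where BOTH of r09's objects are defined
as holomorphic functions; the extension to `|z| < R` in §2 is p10's abstract witness shifted by a constant, not a new
closed formula.  (iii) Nothing printed is contradicted; no SKELETON head changes.

## References
* T. Bałaban, *Renormalization group approach to lattice gauge field theories. I*, Commun. Math. Phys. 109 (1987)
  249–301, §5 p. 294 (PDF 46), the paragraph before (5.22). [Balaban1987RG1]
-/

namespace Literature.MathematicalPhysics.QuantumFieldTheory.Balaban1983to89.B12LaurentSplit522Bridge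

noncomputable section

open _root_.Complex _root_.Metric _root_.Set
open scoped Real Topology
open B12LaurentSplit522 (gPlus gMinus gMinus_zero laurent_split differentiableOn_gPlus differentiableOn_gMinus)
open B12LaurentSplitting522Proof (laurent_splitting laurent_splitting_unique)

/-! ## §0 Radii bookkeeping -/

/-- The circle `|z| = ρ` lies in the ring `R⁻¹ < |z| < R` when `R⁻¹ < ρ < R`. [cite: Balaban1987RG1, §5 p.294] -/
private theorem sphere_subset_ring {R ρ : ℝ} (h₁ : R⁻¹ < ρ) (h₂ : ρ < R) :
    sphere (0 : ℂ) ρ ⊆ {z : ℂ | R⁻¹ < ‖z‖ ∧ ‖z‖ < R} := by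
  intro z hz
  rw [mem_sphere_zero_iff_norm] at hz
  exact ⟨hz ▸ h₁, hz ▸ h₂⟩

variable {R r₁ r₂ : ℝ} {f : ℂ → ℂ}

/-- The common disc radius `R′ = min(r₂, r₁⁻¹)` exceeds `1` when `r₁ < 1 < r₂` (`0 < r₁`).
[cite: Balaban1987RG1, §5 p.294] -/
theorem one_lt_min_radius (hr₁0 : 0 < r₁) (hr₁ : r₁ < 1) (hr₂ : 1 < r₂) : 1 < min r₂ r₁⁻¹ :=
  lt_min hr₂ ((one_lt_inv₀ hr₁0).2 hr₁)

/-! ## §1 «Unique up to an additive constant» across the pair: every holomorphic splitting is r09's pair shifted by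
`g⁻(0)` on the common disc -/

/-- **THE BRIDGE.**  Let `1 < R`, `f` holomorphic on the ring `R⁻¹ < |z| < R`, radii `R⁻¹ < r₁ < 1 < r₂ < R`, and let
`(g⁺, g⁻)` be ANY splitting of `f` with both pieces holomorphic on the disc `|z| < R` and `f(z) = g⁺(z) + g⁻(z⁻¹)` on
the ring (e.g. the witnesses of p10's `laurent_splitting`).  Then on the common disc `|z| < min(r₂, r₁⁻¹)` the
explicit Cauchy-integral pair of record satisfies `gPlus f r₂ z = g⁺ z + g⁻ 0` and `gMinus f r₁ z = g⁻ z − g⁻ 0`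
(print's «unique up to an additive constant», the constant pinned by the normalisation `gMinus f r₁ 0 = 0`).
[cite: Balaban1987RG1, §5 p.294] -/
theorem gPlus_gMinus_eq_of_splitting (hR : 1 < R) (hf : DifferentiableOn ℂ f {z : ℂ | R⁻¹ < ‖z‖ ∧ ‖z‖ < R})
    (hr₁ : R⁻¹ < r₁) (hr₁1 : r₁ < 1) (hr₂1 : 1 < r₂) (hr₂ : r₂ < R) {gp gm : ℂ → ℂ}
    (hgp : DifferentiableOn ℂ gp (ball 0 R)) (hgm : DifferentiableOn ℂ gm (ball 0 R))
    (hsplit : ∀ z : ℂ, R⁻¹ < ‖z‖ → ‖z‖ < R → f z = gp z + gm z⁻¹) :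
    (∀ z ∈ ball (0 : ℂ) (min r₂ r₁⁻¹), gPlus f r₂ z = gp z + gm 0) ∧
      ∀ z ∈ ball (0 : ℂ) (min r₂ r₁⁻¹), gMinus f r₁ z = gm z - gm 0 := by
  have hR0 : 0 < R := one_pos.trans hR
  have hRinv0 : 0 < R⁻¹ := inv_pos.2 hR0
  have hr₁0 : 0 < r₁ := hRinv0.trans hr₁
  set R' := min r₂ r₁⁻¹ with hR'def
  have hR' : 1 < R' := one_lt_min_radius hr₁0 hr₁1 hr₂1
  have hR'r₂ : R' ≤ r₂ := min_le_left _ _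
  have hR'r₁ : R' ≤ r₁⁻¹ := min_le_right _ _
  have hR'R : R' ≤ R := hR'r₂.trans hr₂.le
  -- `R'⁻¹ ≥ r₁`
  have hR'inv : r₁ ≤ R'⁻¹ := by
    have := (inv_le_inv₀ (by positivity : (0:ℝ) < r₁⁻¹) (by linarith : (0:ℝ) < R')).2 hR'r₁
    rwa [inv_inv] at this
  -- holomorphy of the four pieces on the common disc
  have hcont₂ : ContinuousOn f (sphere (0 : ℂ) r₂) :=
    hf.continuousOn.mono (sphere_subset_ring (hr₁.trans (hr₁1.trans hr₂1)) hr₂)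
  have hcont₁ : ContinuousOn f (sphere (0 : ℂ) r₁) :=
    hf.continuousOn.mono (sphere_subset_ring hr₁ (hr₁1.trans (hr₂1.trans hr₂)))
  have hgP : DifferentiableOn ℂ (gPlus f r₂) (ball 0 R') :=
    (differentiableOn_gPlus (hr₁0.trans (hr₁1.trans hr₂1)) hcont₂).mono (ball_subset_ball hR'r₂)
  have hgM : DifferentiableOn ℂ (gMinus f r₁) (ball 0 R') :=
    (differentiableOn_gMinus hr₁0 hcont₁).mono (ball_subset_ball hR'r₁)
  have hgp' : DifferentiableOn ℂ gp (ball 0 R') := hgp.mono (ball_subset_ball hR'R)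
  have hgm' : DifferentiableOn ℂ gm (ball 0 R') := hgm.mono (ball_subset_ball hR'R)
  -- the two splittings agree on the ring `R'⁻¹ < |z| < R'`
  have hagree : ∀ z : ℂ, R'⁻¹ < ‖z‖ → ‖z‖ < R' → gPlus f r₂ z + gMinus f r₁ z⁻¹ = gp z + gm z⁻¹ := by
    intro z hz1 hz2
    have hw₁ : r₁ < ‖z‖ := lt_of_le_of_lt hR'inv hz1
    have hw₂ : ‖z‖ < r₂ := lt_of_lt_of_le hz2 hR'r₂
    rw [← laurent_split hRinv0.le hf hr₁ hr₂ hw₁ hw₂, hsplit z (hr₁.trans hw₁) (hw₂.trans hr₂)]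
  obtain ⟨c, hc1, hc2⟩ := laurent_splitting_unique hR' (gPlus f r₂) (gMinus f r₁) gp gm hgP hgM hgp' hgm' hagree
  -- the constant is `c = −gm 0` by r09's normalisation `gMinus f r₁ 0 = 0`
  have hc0 : c = -gm 0 := by
    have := hc2 0 (mem_ball_self (by linarith))
    rw [gMinus_zero] at this
    linear_combination this
  refine ⟨fun z hz => ?_, fun z hz => ?_⟩
  · have := hc1 z hz; rw [hc0] at this; linear_combination -this
  · have := hc2 z hz; rw [hc0] at this; linear_combination -this

/-- **With the printed normalisation `g⁻(0) = 0` the splitting IS r09's pair** on the common disc.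
[cite: Balaban1987RG1, §5 p.294] -/
theorem gPlus_gMinus_eq_of_splitting_of_norm (hR : 1 < R)
    (hf : DifferentiableOn ℂ f {z : ℂ | R⁻¹ < ‖z‖ ∧ ‖z‖ < R})
    (hr₁ : R⁻¹ < r₁) (hr₁1 : r₁ < 1) (hr₂1 : 1 < r₂) (hr₂ : r₂ < R) {gp gm : ℂ → ℂ}
    (hgp : DifferentiableOn ℂ gp (ball 0 R)) (hgm : DifferentiableOn ℂ gm (ball 0 R))
    (hsplit : ∀ z : ℂ, R⁻¹ < ‖z‖ → ‖z‖ < R → f z = gp z + gm z⁻¹) (hnorm : gm 0 = 0) :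
    (∀ z ∈ ball (0 : ℂ) (min r₂ r₁⁻¹), gPlus f r₂ z = gp z) ∧
      ∀ z ∈ ball (0 : ℂ) (min r₂ r₁⁻¹), gMinus f r₁ z = gm z := by
  obtain ⟨h1, h2⟩ := gPlus_gMinus_eq_of_splitting hR hf hr₁ hr₁1 hr₂1 hr₂ hgp hgm hsplit
  exact ⟨fun z hz => by rw [h1 z hz, hnorm, add_zero], fun z hz => by rw [h2 z hz, hnorm, sub_zero]⟩

/-! ## §2 The (T1) patching: r09's explicit pair extends to the full printed disc and does not depend on the
auxiliary radii -/

/-- **EXTENSION TO THE PRINTED DISC `|z| < R`** (r09's transcript note (T1) made a theorem): there are `G⁺, G⁻`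
holomorphic on the FULL disc `|z| < R`, with `G⁻(0) = 0`, splitting `f` on the WHOLE ring `R⁻¹ < |z| < R`, and
agreeing with the explicit pair `gPlus f r₂`, `gMinus f r₁` on the common disc `|z| < min(r₂, r₁⁻¹)` (p10's
`laurent_splitting` witness shifted by the constant `g⁻(0)`, then §1). [cite: Balaban1987RG1, §5 p.294] -/
theorem exists_extension_gPlus_gMinus (hR : 1 < R) (hf : DifferentiableOn ℂ f {z : ℂ | R⁻¹ < ‖z‖ ∧ ‖z‖ < R})
    (hr₁ : R⁻¹ < r₁) (hr₁1 : r₁ < 1) (hr₂1 : 1 < r₂) (hr₂ : r₂ < R) :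
    ∃ Gp Gm : ℂ → ℂ, DifferentiableOn ℂ Gp (ball 0 R) ∧ DifferentiableOn ℂ Gm (ball 0 R) ∧ Gm 0 = 0 ∧
      (∀ z : ℂ, R⁻¹ < ‖z‖ → ‖z‖ < R → f z = Gp z + Gm z⁻¹) ∧
      (∀ z ∈ ball (0 : ℂ) (min r₂ r₁⁻¹), gPlus f r₂ z = Gp z) ∧
      ∀ z ∈ ball (0 : ℂ) (min r₂ r₁⁻¹), gMinus f r₁ z = Gm z := by
  obtain ⟨gp, gm, hgp, hgm, hsplit⟩ := laurent_splitting hR f hf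
  refine ⟨fun z => gp z + gm 0, fun z => gm z - gm 0, hgp.add_const _, hgm.sub_const _, sub_self _,
    fun z hz1 hz2 => ?_, ?_⟩
  · rw [hsplit z hz1 hz2]; ring
  · exact gPlus_gMinus_eq_of_splitting hR hf hr₁ hr₁1 hr₂1 hr₂ hgp hgm hsplit

/-- **Radius independence of `g⁺`**: r09's `gPlus f r₂` does not depend on the auxiliary outer radius — for
`1 < r₂, r₂′ < R`, `gPlus f r₂ = gPlus f r₂′` on the common disc `|z| < min(r₂, r₂′)` (apply §1 with the inner radius
`r₁ = max(r₂, r₂′)⁻¹`). [cite: Balaban1987RG1, §5 p.294] -/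
theorem gPlus_eq_gPlus_of_radii (hR : 1 < R) (hf : DifferentiableOn ℂ f {z : ℂ | R⁻¹ < ‖z‖ ∧ ‖z‖ < R})
    (hr₂1 : 1 < r₂) (hr₂ : r₂ < R) {r₂' : ℝ} (hr₂'1 : 1 < r₂') (hr₂' : r₂' < R)
    {z : ℂ} (hz : ‖z‖ < min r₂ r₂') : gPlus f r₂ z = gPlus f r₂' z := by
  obtain ⟨gp, gm, hgp, hgm, hsplit⟩ := laurent_splitting hR f hf
  have hR0 : 0 < R := one_pos.trans hR
  -- inner radius `r₁ = (max r₂ r₂')⁻¹`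
  set m := max r₂ r₂' with hm
  have hm1 : 1 < m := lt_max_of_lt_left hr₂1
  have hm0 : 0 < m := one_pos.trans hm1
  have hmR : m < R := max_lt hr₂ hr₂'
  have hr₁ : R⁻¹ < m⁻¹ := (inv_lt_inv₀ hR0 hm0).2 hmR
  have hr₁1 : m⁻¹ < 1 := inv_lt_one_of_one_lt₀ hm1
  obtain ⟨h1, -⟩ := gPlus_gMinus_eq_of_splitting hR hf hr₁ hr₁1 hr₂1 hr₂ hgp hgm hsplit
  obtain ⟨h1', -⟩ := gPlus_gMinus_eq_of_splitting hR hf hr₁ hr₁1 hr₂'1 hr₂' hgp hgm hsplit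
  have hz1 : z ∈ ball (0 : ℂ) (min r₂ m⁻¹⁻¹) := by
    rw [inv_inv, mem_ball_zero_iff]
    exact hz.trans_le (le_min (min_le_left _ _) ((min_le_left _ _).trans (le_max_left _ _)))
  have hz2 : z ∈ ball (0 : ℂ) (min r₂' m⁻¹⁻¹) := by
    rw [inv_inv, mem_ball_zero_iff]
    exact hz.trans_le (le_min (min_le_right _ _) ((min_le_right _ _).trans (le_max_right _ _)))
  rw [h1 z hz1, h1' z hz2]

/-- **Radius independence of `g⁻`**: r09's `gMinus f r₁` does not depend on the auxiliary inner radius — for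
`R⁻¹ < r₁, r₁′ < 1`, `gMinus f r₁ = gMinus f r₁′` on the common disc `|z| < min(r₁⁻¹, r₁′⁻¹)` (apply §1 with the outer
radius `r₂ = max(r₁⁻¹, r₁′⁻¹)`). [cite: Balaban1987RG1, §5 p.294] -/
theorem gMinus_eq_gMinus_of_radii (hR : 1 < R) (hf : DifferentiableOn ℂ f {z : ℂ | R⁻¹ < ‖z‖ ∧ ‖z‖ < R})
    (hr₁ : R⁻¹ < r₁) (hr₁1 : r₁ < 1) {r₁' : ℝ} (hr₁' : R⁻¹ < r₁') (hr₁'1 : r₁' < 1)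
    {z : ℂ} (hz : ‖z‖ < min r₁⁻¹ r₁'⁻¹) : gMinus f r₁ z = gMinus f r₁' z := by
  obtain ⟨gp, gm, hgp, hgm, hsplit⟩ := laurent_splitting hR f hf
  have hR0 : 0 < R := one_pos.trans hR
  have hRinv0 : 0 < R⁻¹ := inv_pos.2 hR0
  have hr₁0 : 0 < r₁ := hRinv0.trans hr₁
  have hr₁'0 : 0 < r₁' := hRinv0.trans hr₁'
  -- outer radius `r₂ = max r₁⁻¹ r₁'⁻¹`
  set M := max r₁⁻¹ r₁'⁻¹ with hM
  have hM1 : 1 < M := lt_max_of_lt_left ((one_lt_inv₀ hr₁0).2 hr₁1)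
  have hMR : M < R := by
    refine max_lt ?_ ?_
    · have := (inv_lt_inv₀ hr₁0 hRinv0).2 hr₁; rwa [inv_inv] at this
    · have := (inv_lt_inv₀ hr₁'0 hRinv0).2 hr₁'; rwa [inv_inv] at this
  obtain ⟨-, h2⟩ := gPlus_gMinus_eq_of_splitting hR hf hr₁ hr₁1 hM1 hMR hgp hgm hsplit
  obtain ⟨-, h2'⟩ := gPlus_gMinus_eq_of_splitting hR hf hr₁' hr₁'1 hM1 hMR hgp hgm hsplit
  have hz1 : z ∈ ball (0 : ℂ) (min M r₁⁻¹) := by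
    rw [mem_ball_zero_iff]
    exact hz.trans_le (le_min ((min_le_left _ _).trans (le_max_left _ _)) (min_le_left _ _))
  have hz2 : z ∈ ball (0 : ℂ) (min M r₁'⁻¹) := by
    rw [mem_ball_zero_iff]
    exact hz.trans_le (le_min ((min_le_right _ _).trans (le_max_right _ _)) (min_le_right _ _))
  rw [h2 z hz1, h2' z hz2]

/-- **p10's witnesses versus r09's pair, as an ∃-statement over the twin's theorem**: the splitting produced by
`B12LaurentSplitting522Proof.laurent_splitting` coincides with (`gPlus f r₂ − c`, `gMinus f r₁ + c`) on the common
disc for the constant `c = g⁻(0)` of that witness. [cite: Balaban1987RG1, §5 p.294] -/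
theorem exists_const_laurent_splitting_eq (hR : 1 < R) (hf : DifferentiableOn ℂ f {z : ℂ | R⁻¹ < ‖z‖ ∧ ‖z‖ < R})
    (hr₁ : R⁻¹ < r₁) (hr₁1 : r₁ < 1) (hr₂1 : 1 < r₂) (hr₂ : r₂ < R) {gp gm : ℂ → ℂ}
    (hgp : DifferentiableOn ℂ gp (ball 0 R)) (hgm : DifferentiableOn ℂ gm (ball 0 R))
    (hsplit : ∀ z : ℂ, R⁻¹ < ‖z‖ → ‖z‖ < R → f z = gp z + gm z⁻¹) :
    ∃ c : ℂ, (∀ z ∈ ball (0 : ℂ) (min r₂ r₁⁻¹), gp z = gPlus f r₂ z - c) ∧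
      ∀ z ∈ ball (0 : ℂ) (min r₂ r₁⁻¹), gm z = gMinus f r₁ z + c := by
  obtain ⟨h1, h2⟩ := gPlus_gMinus_eq_of_splitting hR hf hr₁ hr₁1 hr₂1 hr₂ hgp hgm hsplit
  exact ⟨gm 0, fun z hz => by rw [h1 z hz]; ring, fun z hz => by rw [h2 z hz]; ring⟩

end

end Literature.MathematicalPhysics.QuantumFieldTheory.Balaban1983to89.B12LaurentSplit522Bridge
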